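import Summits.QuantumFields.YangMills.Theorems.UnitScaleTiltProp7OneFormConjugateResolventKFree
import Summits.QuantumFields.YangMills.Theorems.UnitScaleTiltProp7Delta3Linear
import Summits.QuantumFields.YangMills.Theorems.UnitScaleTiltProp7KernelRow349AllMembers
import Summits.QuantumFields.YangMills.Theorems.UnitScaleTiltProp7LiftOfRSEqPrintProjector
import HarnessLib

/-!
# Route `UnitScaleTilt`, crux K1 «MinimiserStabilityRegPr» (stmt-QuantumFields-19200), EX rows `h137kπ` ∕ `h137kΔ` ∕ `hCk` — **K-STOREY BRICK (K2b-δ₃)-D″ (px12 g17): THE `δ₃` FAMILY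
# (the (δ₃) family letter of px10 g13's (K2-KNIT) Idx edition ✓p768818 v1.1 §3 `kinvRow_family_of_coercive_of_conjResolvent`)** — for positive L-only weights `c₀ cB` and a coupling
# window `0 < a₀ ≤ a₁` there are L-only `αδ rδ Aδ Bδ` such that at every member `i : Idx L` (`L > 1`), every `RegPr ρ U₀` with `ρ ≤ α′ ≤ αδ L`, on the Lift locus, every coupling
# `a₀(c₀∕cB)ℓ³ ≤ a ≤ a₁(c₀∕cB)ℓ³`, every slope `0 < r ≤ rδ L`, every phase `|φ x − φ x′| ≤ r·η·tdist x x′` and all multipliers `M_f ↔ e^{φ(b₋)}`, `M_fi ↔ e^{−φ(b₋)}`: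
# **`‖M_f(G_T(M_fi x)) − G_T x‖ ≤ (Aδ L·r + Bδ L·α′)·‖x‖`** at the slot of record — TWO KNOBS (slope `r`, regularity cap `α′`) left to the knit's window (R_L), both with L-only rates.
# = (K2b-δ₃)-D′ ✓∕⧗`conj_resolvent_oneForm_phaseClass_kfree` ∘ (γ) ✓`hco_DeltaEtaSlot_exists` ∘ h349 ✓`kernelRow349_allMembers_exists` (R_S-text via ✓`exists_intertwiner_of_regPr` +
# ✓`RS_eq_projR_iff_lift`, px16's (c) pattern token for token) ∘ the numerics ✓∕⧗`Prop7Delta3Linear.delta3_le_linear`.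

Cell `ym3-torus` (HUMAN RULING D-0037: SU(2) YM₃ on T³ is ladder rung R3 — NOT d = 4, NOT infinite volume, NOT a mass gap, NOT Clay).  Width seat `ym3-torus-px12` gen 17.  THEOREMS ONLY
(0 `def`, 0 `sorry`); `--supports stmt-QuantumFields-19200 --as helper`, count-neutral.  HONEST LABEL: ∃-packaging of landed theorems; CONDITIONAL on the Lift antecedent (displayed in the
conclusion, discharged at the junction by ✓`hIrrLift_of_record`); nothing of (3.132), `h137kπ`, `h137kΔ`, `hCk`, EX or 19200 is proved here.

WHAT IS PROVED (ns `Summit.QuantumFields.YangMills.Theorems.Prop7OneFormConjugateResolventFamily`): ★★★ `conj_resolvent_oneForm_phaseClass_family` (statement above; `αδ` carries the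
windows `10¹²L³`, `10¹⁰L⁶`, `13·10¹⁴L³`).
HYP-SAT (★★OWNER RULING №42): no displayed analytic letter remains except Lift; nothing eventual; no restatement.

References: T. Bałaban, CMP **99** (1985) 389–434 [Balaban1985BackgroundPropagators] (Thm 3.1 (3.46)–(3.49) pp.398–399, Thm 3.11 p.416, (3.132) p.422); CMP **102** (1985) 277–309
[Balaban1985Variational] (Thm 1 p.279); S. Agmon, *Lectures on exponential decay* (Princeton 1982) Ch. 1 [Agmon1982].
-/

set_option autoImplicit false

noncomputable section

open scoped Matrix.Norms.L2Operator BigOperators InnerProductSpace ComplexConjugate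

namespace Summit.QuantumFields.YangMills.Theorems.Prop7OneFormConjugateResolventFamily

open Literature.MathematicalPhysics.QuantumFieldTheory.Balaban1983to89
open Literature.MathematicalPhysics.QuantumFieldTheory.Balaban1983to89.T3ContinuumYM3Torus
open Literature.MathematicalPhysics.QuantumFieldTheory.Balaban1983to89.T3PrintedRegularMinimiser (RegPr)
open Literature.MathematicalPhysics.QuantumFieldTheory.Balaban1983to89.T3PrintedMinimiserExistence (regPr_mono)
open B15DeterminingSets (embIter)
open T3SectALandauChart (formComp bgUnits eta eta_pos)
open B9SectCLatticeCarrier (Bond)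
open B9Eq311L2Pairing (WL2)
open B11Eq103H1Complex (BondL2K projR)
open B5Eq118OneStroke (iterBlockOf)
open Summit.QuantumFields.YangMills.Theorems.Prop8Chart (emlIterU)
open Summit.QuantumFields.YangMills.Theorems.Prop7SectET3Transport (periodsT3 bondEquiv)
open Summit.QuantumFields.YangMills.Theorems.Prop7SectET3HilbertLetters (W₂ frobEquiv toL2 toL2S DL2 DstarL2 covLapSite)
open Summit.QuantumFields.YangMills.Theorems.Prop7SectET3WilsonHessian (DeltaEtaSlot)
open Summit.QuantumFields.YangMills.Theorems.Prop7SectET3GaugeProjector (RS)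
open Summit.QuantumFields.YangMills.Theorems.Prop7SectET3CurvedPropagators (laplaceA Qk GT PosOnto)
open Summit.QuantumFields.YangMills.Theorems.Prop7OneFormCoerciveHolds (hco_DeltaEtaSlot_exists)
open Summit.QuantumFields.YangMills.Theorems.Prop7KernelRow349AllMembers (kernelRow349_allMembers_exists)
open Summit.QuantumFields.YangMills.Theorems.Prop7LiftOfRSEqPrintProjector (RS_eq_projR_iff_lift)
open Summit.QuantumFields.YangMills.Theorems.Prop7NSIntertwinerOfRecord (exists_intertwiner_of_regPr)
open Summit.QuantumFields.YangMills.Theorems.Prop7OneFormConjugateResolventKFree (conj_resolvent_oneForm_phaseClass_kfree sq_sqrt3_mul)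
open Summit.QuantumFields.YangMills.Theorems.Prop7OneFormGreenKFreeNumerics (rbudget_le theta_ge_half_of_budgets)
open Summit.QuantumFields.YangMills.Theorems.Prop7Delta3Linear (delta3_le_linear)

/-- ★★★ **THE `δ₃` FAMILY, LINEAR IN THE TWO KNOBS.**  For positive L-only weights `c₀ cB` and a coupling window `0 < a₀ ≤ a₁` there are `αδ rδ Aδ Bδ : ℕ → ℝ` with `0 < αδ L`,
`10¹²L³αδ L ≤ 1`, `10¹⁰L⁶αδ L ≤ 1`, `13·10¹⁴L³αδ L ≤ 1`, `0 < rδ L`, `0 ≤ Aδ L`, `0 ≤ Bδ L`, and: for every `L > 1`, every slope `0 < r ≤ rδ L`, every cap `0 < α′ ≤ αδ L`, member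
`i : Idx L`, background `U₀` with `RegPr ρ U₀`, `ρ ≤ α′`, under `Lift`, coupling `a₀(c₀ L∕cB L)ℓ³ ≤ a ≤ a₁(c₀ L∕cB L)ℓ³`, every phase `φ` with `|φ x − φ x′| ≤ r·η·tdist x x′`, all linear
`M_f ↔ e^{φ(b₋)}`, `M_fi ↔ e^{−φ(b₋)}` and all `x`: `‖M_f(G_T(M_fi x)) − G_T x‖ ≤ (Aδ L·r + Bδ L·α′)·‖x‖`, `G_T = GT … a (DeltaEtaSlot …) U₀`.
[cite: Balaban1985BackgroundPropagators, Thm 3.1 (3.46)–(3.49) pp.398–399, Thm 3.11 p.416, (3.132) p.422; Balaban1985Variational, Thm 1 p.279; Agmon1982, Ch. 1] -/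
theorem conj_resolvent_oneForm_phaseClass_family (c₀ cB : ℕ → ℝ) [hc₀ : ∀ L : ℕ, Fact (0 < c₀ L)] [hcB : ∀ L : ℕ, Fact (0 < cB L)] {a₀ a₁ : ℝ} (ha₀ : 0 < a₀) (ha₀₁ : a₀ ≤ a₁) :
    ∃ (αδ rδ Aδ Bδ : ℕ → ℝ),
      (∀ L : ℕ, 1 < L → 0 < αδ L) ∧ (∀ L : ℕ, 1 < L → 10 ^ 12 * (L : ℝ) ^ 3 * αδ L ≤ 1) ∧ (∀ L : ℕ, 1 < L → 10 ^ 10 * (L : ℝ) ^ 6 * αδ L ≤ 1) ∧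
      (∀ L : ℕ, 1 < L → 13 * 10 ^ 14 * (L : ℝ) ^ 3 * αδ L ≤ 1) ∧ (∀ L : ℕ, 1 < L → 0 < rδ L) ∧ (∀ L : ℕ, 1 < L → 0 ≤ Aδ L) ∧ (∀ L : ℕ, 1 < L → 0 ≤ Bδ L) ∧
    ∀ (L : ℕ), 1 < L → ∀ (r : ℝ), 0 < r → r ≤ rδ L → ∀ (α' : ℝ), 0 < α' → α' ≤ αδ L →
      ∀ (i : T3Thm1Carrier.Idx L) (U₀ : GaugeField (i.1.1.P i.1.2.2) 0 (Matrix.specialUnitaryGroup (Fin 2) ℂ)), ∀ ρ : ℝ, RegPr i.1.1 i.1.2.1 i.1.2.2 ρ U₀ → ρ ≤ α' →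
        (∀ cf : Site (i.1.1.P i.1.2.2) (i.1.2.2 - i.1.2.1) → Matrix (Fin 2) (Fin 2) ℂ,
        (∀ e' : PBond (i.1.1.P i.1.2.2) (i.1.2.2 - i.1.2.1), cf e'.src = ((emlIterU (i.1.2.2 - i.1.2.1) (bgUnits i.1.1 i.1.2.2 U₀) e' : (Matrix (Fin 2) (Fin 2) ℂ)ˣ) : Matrix (Fin 2) (Fin 2) ℂ) * cf e'.tgt *
        (((emlIterU (i.1.2.2 - i.1.2.1) (bgUnits i.1.1 i.1.2.2 U₀) e')⁻¹ : (Matrix (Fin 2) (Fin 2) ℂ)ˣ) : Matrix (Fin 2) (Fin 2) ℂ)) →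
        ∃ l₀ : Site (i.1.1.P i.1.2.2) 0 → Matrix (Fin 2) (Fin 2) ℂ,
        (∀ b' : PBond (i.1.1.P i.1.2.2) 0, l₀ b'.src = ((bgUnits i.1.1 i.1.2.2 U₀ b' : (Matrix (Fin 2) (Fin 2) ℂ)ˣ) : Matrix (Fin 2) (Fin 2) ℂ) * l₀ b'.tgt * (((bgUnits i.1.1 i.1.2.2 U₀ b')⁻¹ : (Matrix (Fin 2) (Fin 2) ℂ)ˣ) : Matrix (Fin 2) (Fin 2) ℂ)) ∧
        ∀ y : Site (i.1.1.P i.1.2.2) (i.1.2.2 - i.1.2.1), l₀ (embIter (i.1.2.2 - i.1.2.1) y) = cf y) →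
      ∀ a : ℝ, a₀ * (c₀ L / cB L) * ((i.1.1.L : ℝ) ^ (i.1.2.2 - i.1.2.1)) ^ 3 ≤ a → a ≤ a₁ * (c₀ L / cB L) * ((i.1.1.L : ℝ) ^ (i.1.2.2 - i.1.2.1)) ^ 3 →
      ∀ φ : Site (i.1.1.P i.1.2.2) 0 → ℝ, (∀ x x' : Site (i.1.1.P i.1.2.2) 0, |φ x - φ x'| ≤ r * eta i.1.1 i.1.2.1 i.1.2.2 * (Site.tdist x x' : ℝ)) →
      ∀ (Mf Mfi : BondL2K ℂ 3 (periodsT3 i.1.1 i.1.2.2) (c₀ L) W₂ →ₗ[ℂ] BondL2K ℂ 3 (periodsT3 i.1.1 i.1.2.2) (c₀ L) W₂),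
        (∀ X : PBond (i.1.1.P i.1.2.2) 0 → Matrix (Fin 2) (Fin 2) ℂ, Mf (toL2 i.1.1 i.1.2.2 (c₀ L) X) = toL2 i.1.1 i.1.2.2 (c₀ L) (fun b => Real.exp (φ b.src) • X b)) →
        (∀ X : PBond (i.1.1.P i.1.2.2) 0 → Matrix (Fin 2) (Fin 2) ℂ, Mfi (toL2 i.1.1 i.1.2.2 (c₀ L) X) = toL2 i.1.1 i.1.2.2 (c₀ L) (fun b => (Real.exp (φ b.src))⁻¹ • X b)) →
      ∀ x : BondL2K ℂ 3 (periodsT3 i.1.1 i.1.2.2) (c₀ L) W₂,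
        ‖Mf (GT i.1.1 i.1.2.1 i.1.2.2 i.2.2.le (c₀ L) (cB L) a (DeltaEtaSlot i.1.1 i.1.2.1 i.1.2.2 (c₀ L)) U₀ (Mfi x))
            - GT i.1.1 i.1.2.1 i.1.2.2 i.2.2.le (c₀ L) (cB L) a (DeltaEtaSlot i.1.1 i.1.2.1 i.1.2.2 (c₀ L)) U₀ x‖
          ≤ (Aδ L * r + Bδ L * α') * ‖x‖ := by
  obtain ⟨αco, γco, hαco, hWco, hwinco, hγco, hco⟩ := hco_DeltaEtaSlot_exists c₀ cB ha₀
  obtain ⟨αK, CK, δK, hαK, hWK, hCK, hδK, hkD⟩ := kernelRow349_allMembers_exists c₀ cB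
  -- the L-only choices (px16's D2 budgets)
  set CV1 : ℝ := 32 * Real.sqrt 2 * 648 + (33 / 8 : ℝ) ^ 2 * (600 * (27 / 4 : ℝ) ^ 6) with hCV1
  have hCV1pos : 0 < CV1 := by rw [hCV1]; positivity
  have ha₁ : 0 ≤ a₁ := le_trans ha₀.le ha₀₁
  set T : ℕ → ℝ := fun L => 5000 * a₁ + 27 * Real.sqrt 2 * CK L * (2 * (1 + 4 / δK L)) ^ 3 / min 1 (δK L / 4) with hT
  set ε : ℕ → ℝ := fun L => min (1 / 8) (γco L / (8 * CV1)) with hε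
  set rδ : ℕ → ℝ := fun L => min (min (1 / 4) (δK L / 2)) (min (γco L * ε L / 48) (γco L / (16 * (T L + 1)))) with hrδ
  set αδ : ℕ → ℝ := fun L => min (min (αco L) (αK L)) (min ((10 ^ 10 * (L : ℝ) ^ 6)⁻¹) (γco L / (16 * 10 ^ 5))) with hαδ
  set Aδ : ℕ → ℝ := fun L => (Real.sqrt (γco L))⁻¹ * (Real.sqrt 3 * Real.exp (1 / 4) * Real.sqrt (1 + CV1 / γco L) * (2 / γco L)
      + Real.sqrt 3 * Real.exp (1 / 4) * (Real.sqrt (γco L))⁻¹ * Real.sqrt ((2 / γco L + (γco L / 4 + CV1) * (2 / γco L) ^ 2) / (7 / 8))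
      + (3 * Real.exp (1 / 2) / 4 + T L) * (Real.sqrt (γco L))⁻¹ * (2 / γco L)) with hAδ
  set Bδ : ℕ → ℝ := fun L => (Real.sqrt (γco L))⁻¹ * 10 ^ 5 * (Real.sqrt (γco L))⁻¹ * (2 / γco L) with hBδ
  have hT0 : ∀ L, 1 < L → 0 ≤ T L := fun L hL => by
    have := hCK L hL; have := hδK L hL
    simp only [hT]; positivity
  have hε0 : ∀ L, 1 < L → 0 < ε L := fun L hL => by
    have := hγco L hL; simp only [hε]; exact lt_min (by norm_num) (by positivity)
  have hrδ0 : ∀ L, 1 < L → 0 < rδ L := fun L hL => by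
    have := hγco L hL; have := hδK L hL; have := hε0 L hL; have := hT0 L hL
    simp only [hrδ]; exact lt_min (lt_min (by norm_num) (by positivity)) (lt_min (by positivity) (by positivity))
  have hαδ0 : ∀ L, 1 < L → 0 < αδ L := fun L hL => by
    have := hγco L hL; have := hαco L hL; have := hαK L hL
    have hL0 : (0 : ℝ) < L := by exact_mod_cast lt_trans zero_lt_one hL
    simp only [hαδ]; exact lt_min (lt_min (by assumption) (by assumption)) (lt_min (by positivity) (by positivity))
  refine ⟨αδ, rδ, Aδ, Bδ, hαδ0, fun L hL => ?_, fun L hL => ?_, fun L hL => ?_, hrδ0, fun L hL => ?_, fun L hL => ?_, ?_⟩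
  · have h1 : αδ L ≤ αco L := by simp only [hαδ]; exact (min_le_left _ _).trans (min_le_left _ _)
    have hL0 : (0 : ℝ) < L := by exact_mod_cast lt_trans zero_lt_one hL
    exact (mul_le_mul_of_nonneg_left h1 (by positivity)).trans (hWco L hL)
  · have hL0 : (0 : ℝ) < L := by exact_mod_cast lt_trans zero_lt_one hL
    have h1 : αδ L ≤ (10 ^ 10 * (L : ℝ) ^ 6)⁻¹ := by simp only [hαδ]; exact (min_le_right _ _).trans (min_le_left _ _)
    calc 10 ^ 10 * (L : ℝ) ^ 6 * αδ L ≤ 10 ^ 10 * (L : ℝ) ^ 6 * (10 ^ 10 * (L : ℝ) ^ 6)⁻¹ := mul_le_mul_of_nonneg_left h1 (by positivity)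
      _ = 1 := mul_inv_cancel₀ (by positivity)
  · have h1 : αδ L ≤ αco L := by simp only [hαδ]; exact (min_le_left _ _).trans (min_le_left _ _)
    have hL0 : (0 : ℝ) < L := by exact_mod_cast lt_trans zero_lt_one hL
    exact (mul_le_mul_of_nonneg_left h1 (by positivity)).trans (hwinco L hL)
  · have := hγco L hL; have := hT0 L hL
    simp only [hAδ]; positivity
  · have := hγco L hL
    simp only [hBδ]; positivity
  -- the member
  intro L hL r hr hrle α' hα' hα'le i U₀ ρ hreg hρ hlift a ha₀a ha₁a φ hφ' Mf Mfi hMf hMfi x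
  have hγ := hγco L hL
  have hCKL := hCK L hL
  have hδKL := hδK L hL
  have hεL := hε0 L hL
  have hrL := hrδ0 L hL
  have hTL := hT0 L hL
  have hαL := hαδ0 L hL
  have hc₀L : 0 < c₀ L := (hc₀ L).out
  have hcBL : 0 < cB L := (hcB L).out
  have hL0 : (0 : ℝ) < L := by exact_mod_cast lt_trans zero_lt_one hL
  have hLL : (L : ℝ) = (i.1.1.L : ℝ) := by rw [i.2.1]
  -- the caps at this member (`F.L = L`)
  have hαco' : α' ≤ αco L := hα'le.trans (by simp only [hαδ]; exact (min_le_left _ _).trans (min_le_left _ _))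
  have hαK' : α' ≤ αK L := hα'le.trans (by simp only [hαδ]; exact (min_le_left _ _).trans (min_le_right _ _))
  have hαγ' : α' ≤ γco L / (16 * 10 ^ 5) := hα'le.trans (by simp only [hαδ]; exact (min_le_right _ _).trans (min_le_right _ _))
  have hW1 : 10 ^ 12 * (i.1.1.L : ℝ) ^ 3 * α' ≤ 1 := by
    rw [← hLL]; exact (mul_le_mul_of_nonneg_left hαco' (by positivity)).trans (hWco L hL)
  have hW2 : 10 ^ 10 * (i.1.1.L : ℝ) ^ 6 * α' ≤ 1 := by
    rw [← hLL]
    have h1 : α' ≤ (10 ^ 10 * (L : ℝ) ^ 6)⁻¹ := hα'le.trans (by simp only [hαδ]; exact (min_le_right _ _).trans (min_le_left _ _))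
    calc 10 ^ 10 * (L : ℝ) ^ 6 * α' ≤ 10 ^ 10 * (L : ℝ) ^ 6 * (10 ^ 10 * (L : ℝ) ^ 6)⁻¹ := mul_le_mul_of_nonneg_left h1 (by positivity)
      _ = 1 := mul_inv_cancel₀ (by positivity)
  have hW3 : 13 * 10 ^ 14 * (i.1.1.L : ℝ) ^ 3 * α' ≤ 1 := by
    rw [← hLL]; exact (mul_le_mul_of_nonneg_left hαco' (by positivity)).trans (hwinco L hL)
  have hreg' : RegPr i.1.1 i.1.2.1 i.1.2.2 α' U₀ := regPr_mono i.1.1 hρ hreg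
  have hregK : RegPr i.1.1 i.1.2.1 i.1.2.2 (αK L) U₀ := regPr_mono i.1.1 (hρ.trans hαK') hreg
  -- (γ) at this member
  have hco' := hco L hL i U₀ ρ hreg (hρ.trans hαco') hlift a ha₀a
  -- hk_D at this member, in `R_S`-text under `Lift`
  obtain ⟨Q'', D', hint, hD', htop, hseq, hker⟩ :=
    exists_intertwiner_of_regPr i.1.1 i.2.2.le (c₀ := c₀ L) (cB L) hα' hW1 U₀ hreg'
  have hRS : RS i.1.1 i.1.2.1 i.1.2.2 i.2.2.le (c₀ L) (cB L) U₀ = projR (covLapSite i.1.1 i.1.2.1 i.1.2.2 (c₀ L) U₀) Q'' :=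
    (RS_eq_projR_iff_lift i.1.1 i.2.2.le (cB L) hα' hW1 U₀ hreg' Q'' htop hker).2 hlift
  have hkD' := hkD L hL i U₀ hregK Q'' htop hker
  rw [← hRS, hLL] at hkD'
  -- the coupling window gives `0 ≤ a`
  have ha : 0 ≤ a := le_trans (by positivity) ha₀a
  -- the budgets at the user's slope `r ≤ rδ L` and cap `α′`
  have hε8 : ε L ≤ 1 / 8 := by simp only [hε]; exact min_le_left _ _
  have hεC : ε L * CV1 ≤ γco L / 8 := by
    have h1 : ε L ≤ γco L / (8 * CV1) := by simp only [hε]; exact min_le_right _ _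
    calc ε L * CV1 ≤ γco L / (8 * CV1) * CV1 := mul_le_mul_of_nonneg_right h1 hCV1pos.le
      _ = γco L / 8 := by field_simp
  have hr4 : r ≤ 1 / 4 := hrle.trans (by simp only [hrδ]; exact (min_le_left _ _).trans (min_le_left _ _))
  have hrδ' : r ≤ δK L / 2 := hrle.trans (by simp only [hrδ]; exact (min_le_left _ _).trans (min_le_right _ _))
  have hrγ : r ≤ γco L * ε L / 48 := hrle.trans (by simp only [hrδ]; exact (min_le_right _ _).trans (min_le_left _ _))
  have hrT : r * T L ≤ γco L / 16 := by
    have h1 : r ≤ γco L / (16 * (T L + 1)) := hrle.trans (by simp only [hrδ]; exact (min_le_right _ _).trans (min_le_right _ _))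
    calc r * T L ≤ r * (T L + 1) := mul_le_mul_of_nonneg_left (by linarith) hr.le
      _ ≤ γco L / (16 * (T L + 1)) * (T L + 1) := mul_le_mul_of_nonneg_right h1 (by linarith)
      _ = γco L / 16 := by field_simp
  have hαγ : 10 ^ 5 * α' ≤ γco L / 16 := by
    calc 10 ^ 5 * α' ≤ 10 ^ 5 * (γco L / (16 * 10 ^ 5)) := mul_le_mul_of_nonneg_left hαγ' (by positivity)
      _ = γco L / 16 := by field_simp
  -- the K-free member theorem at `ε₀ := α′`
  have hmain := conj_resolvent_oneForm_phaseClass_kfree i.1.1 i.2.2.le (c₀ L) (cB L) i.2.2 hα' hW1 hW2 hW3 U₀ hreg' hlift ha ha₁a hγ hco' hCKL hδKL hkD'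
    hr hr4 hrδ' hεL hε8 hεC hrγ (by simp only [hT] at hrT; exact hrT) hαγ φ hφ' Mf Mfi hMf hMfi x
  -- the linear majorant of δ₃
  have hbud : (Real.sqrt 3 * r * Real.exp r) ^ 2 * (1 + 1 / ε L) ≤ γco L / 16 := by
    rw [sq_sqrt3_mul]; exact rbudget_le hγ.le hr hr4 hεL (by linarith) hrγ
  have hθ8 : r * T L + 10 ^ 5 * α' ≤ γco L / 8 := by linarith
  have hR := hbud.trans (show γco L / 16 ≤ γco L / 8 by linarith [hγ.le])
  have hΘhalf := theta_ge_half_of_budgets (CV := CV1) (θV := r * T L + 10 ^ 5 * α') hγ.le hε8 hεC (by rw [← sq_sqrt3_mul]; exact hR) hθ8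
  have hlin := delta3_le_linear (CV := CV1) (T := T L) hγ hCV1pos.le hTL hr hr4 hεL hε8 hα'.le hbud hθ8 (by rw [sq_sqrt3_mul]; exact hΘhalf)
  refine hmain.trans (mul_le_mul_of_nonneg_right ?_ (norm_nonneg _))
  simp only [hT] at hlin ⊢
  exact hlin

end Summit.QuantumFields.YangMills.Theorems.Prop7OneFormConjugateResolventFamily

end
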